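import Literature.MathematicalPhysics.QuantumFieldTheory.Balaban1983to89.B9Eq3105FamThreeCore

/-!
# `Balaban1983to89.B9Eq3105FamThreeMember` — FAMILY 3 OF (3.105) AT THE LETTERS, THE MEMBER-LETTER WORDS AT THE CONSUMER's LETTERS: the three words
# `(M_χΔ)·S·G′ + G′·S·(ΔM_χ) − (M_χΔ)·S·(ΔM_χ)` of the re-telescoped located difference `ζ_□̃·(DPD*(U₁) − DP_□D*(V′))·h_□` estimated on the member's bond
# carrier from the (3.42) blocks of `G′(U₁)`, the block-locality of `Q′, Q′*`, a (3.48) block of `X⁻¹(U₁)` and the DISPLAYED located `G′`-difference entries;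
# the outer cut-offs put back; F3-C's binder `hX` delivered modulo the `C`-difference word (sub-row G-B9-LETTERS, GAPS G-B9-05∕family 3, programme FAMTHREE
# FILE F3-B, second half; lead g34 RULING FAMTHREE-2 2026-08-29 00:30Z; memo `lit-balaban-p33/g102/FAMTHREE-SCOPE.md` v2 + amendments (A1)∕(A2))

statement-level skeleton of published theorems with citation tags; proofs where landed; nothing here is a claim about the Yang–Mills mass gap

THE PRINTED LOCUS (verbatim, held `paper:balaban1985-cmp99-background-propagators`, journal page = PDF page + 388).  p. 414 (3.105), third sum:
«− Σ_□ ζ_□̃(DPD* − DP_□D*)h_□G_□h_□»; p. 415 l.29–37: «Next we replace the operators G′_{□₀} and C_{□₀} by G′_□, C_□, terms with the differences G′_{□₀} − G′_□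
and C_{□₀} − C_□ are small by the same reason as before. … ζ_□̃DG′_□Q′*C_□Q′G′_□D*h_□G_□h_□ = ζ_□̃DP_□D*h_□G_□h_□. This expression cancels the second term in the
third sum.»; p. 412 l.22–36 (the [2] mechanism for differences of propagators on two domains); p. 399 l.19–24; (3.49) p. 399; (3.25) p. 394; Thm 3.1 (3.42) p. 397;
Thm 3.2 (3.48) p. 398; (3.87) p. 409; Cor. 3.6 p. 408; [4] (2.51)–(2.55) p. 232, Lemma 2.1 (2.60)–(2.61) p. 234; [2] = `Balaban1983RegularityDecay`, (1.11)–(1.12).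

OURS, NOT PRINT's (lead g34 RULING FAMTHREE-2, condition — repeated from `B9Eq3105FamThreeCore`): the re-telescoping and the located estimate of its three member
words are a KERNEL-LEVEL DEVICE OF OURS for the (R)-design letters; print's p. 415 argument is a random-walk expansion of `P` ((3.90), (3.98)) followed by the
cancellation «This expression cancels the second term in the third sum.» — quoted, NOT reproduced.

WHAT THIS FILE CERTIFIES (kernel-checked; 0 `def`, 0 `def … : Prop`, 0 sorry; standard axioms only)

* §4 ★★★ `hasMajorant_conj_memberWords` — the three member words of (A1) at the consumer's letters (`A = G′(cfg U₁)` from `hE : EBlock (kernelFamilySInv …) B_G δ_G U₁`,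
  `B = GpCubeY i □ parS V′` inside `Δ` only, the located entries `hDL`∕`hDR` of `M_χ·η²Δ` ∕ `η²Δ·M_χ` DISPLAYED with constant `ε_D ≥ 0`):
  `conj b((D·[(M_χΔ)SA + AS(ΔM_χ) − (M_χΔ)S(ΔM_χ)]·D*)^ℝ) ≺ κ_F3·ℓ(a)⁻²·e^{−ρd}`, `κ_F3 = (M₂Σ‖b_j‖)²B₁Λ⁴c₁²·(d+1)·ε_D·(2K_G + ε_D)` (vanishes with `ε_D`).
* §5 ★★★ `hasMajorant_famThree_member_located` — with the outer cut-offs, bare `Δ`: for ANY `ζ, h` with `|ζ♭|, |h♭| ≤ 1` whose gradient stencils lie in the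
  plateau `{χ = 1}`: `conj b((M_ζ·D·[ΔSA + ASΔ − ΔSΔ]·D*·M_h)^ℝ) ≺ κ_F3·ℓ(a)⁻²·e^{−ρd}` (`B9Eq3105FamThreeCore.located_words_eq` + §4);
  ★★ `hasMajorant_famThree_located_of_cDiff` — F3-C's binder SHAPE: under F3-A's window hypotheses and a majorant `hT3` of the located cube-letter word
  `conj b((M_ζ·D·G′_□ΣG′_□·D*·M_h)^ℝ) ≺ ε₃·ℓ⁻²·e^{−ρd}` (the `C`-difference word, file F3-B3 — DISPLAYED here),
  `conj b((M_ζ·(DPDsY parS G′ U₁ − DPDsCubeY □ parS V′)·M_h)^ℝ) ≺ (κ_F3 + ε₃)·ℓ(a)⁻²·e^{−ρd}`; ★★ `hasMajorant_famThree_located_zetaY_of_cDiff` — the record's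
  instance `(zetaY, hTY, chiY)` with the plateau hypotheses and `|ζ♭|, |h♭| ≤ 1` DISCHARGED.

HONEST SCOPE ∕ NOT CLAIMED.  (i) DISPLAYED (hypotheses, supplier NONE — GAPS G-B9-05 `hD` species): the located `G′`-difference entries `hDL` (rows cut to `χ_□`,
entry-1 shape) and `hDR` (columns cut, entry-2 shape) with constant `ε_D ≥ 0`; print: O(e^{−2δ₀M}) by [2] (p. 412 l.22–36, p. 399 l.19–24, [2] (1.11)–(1.12)).
In the tree's (R)-design road `hDR` is reachable from p21's `B9ThmDLocDiffAlgebra.sub_eq_comm_form` + `B9ThmDCubePlateau` row laws + p38's site transfer (sources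
near); `hDL` needs the source-global SITE twin of p38's `hasMajorant_conj_bond_sandwich_src_global` (commissioned: p21 `B9Cor36SiteSandwichTransferSrcGlobal`) —
neither is done here.  (ii) DISPLAYED as in Z2-P: `hE` ((3.42) for `G′(U₁)`), `hCinv` ((3.48)), bi-contractive `parS`, `η = |c_f|⁻¹`, the member (2.61) and
transfers; the window hypotheses at `V′` (F3-C∕F3-D plug them from the (3.35) datum, `V′ = Ṽ_□^{u⁻¹}`); `hT3` (file F3-B3).  (iii) Nothing of Thm 3.1 ∕ 3.2 ∕ 3.9
is re-proved.  Count-neutral; NOT a node discharge; no summit ∕ sub-problem statement is proved; nothing continuum ∕ OS ∕ mass-gap ∕ Clay; YM mass gap NOT proved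
(Track A conditional rung).  No `sorry`, no `axiom`, no `… : Prop` fact, no `instance`, no `notation`, no `def`.  NEW file; nothing landed is modified.  Cell
`lit-balaban`, seat `lit-balaban-p33` gen 103, 2026-08-29; `--supports stmt-QuantumFields-19200` as helper.  Net new unproved facts: 0.

RELATED IN THE TREE, NOT DUPLICATED (searched 2026-08-29: `rg 'memberWords|located_of_cDiff' Literature/` = ∅): `B9Eq3105FamThreeCore` (§1–§3, USED BY NAME), Z2-P
`B9Ineq349DPDsYOfEBlock`, F3-A `B9Eq3105FamThreeLetters`, F3-C `B9Eq3105FamThreeCover`, `B9CubeLettersInvReadDict`, `B9Eq3105ZetaY` — all USED BY NAME.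
-/

noncomputable section

namespace Literature.MathematicalPhysics.QuantumFieldTheory.Balaban1983to89.B9Eq3105FamThreeMember

open NormedSpace Complex
open B6RandomWalk (HasMajorant hasMajorant_mono hasMajorant_add Ineq261 c1_nonneg Triangle254)
open B9FromB6 (EBlock)
open B9Thm34Ext (toB6)
open B9Thm37Sum (mulOp mulOp_apply)
open B9Ineq347 (ScaleTransfer)
open B9Eq352DivFormLetters (conj)
open B9Eq352GradLetters (diffLetter)
open B9Ineq368PPrime (hasMajorant_sub)
open B6KLevelCensusIndexV1 (KIdx)
open B6Cover236MultiLevelBlocks (cubes)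
open B6GlobalChartV1 (blkV1)
open B6Geom246MultiLevelBox (blkOf)
open B6Ineq2142KLevelV1 (β)
open B9GeoNormsKLevelV1 (geo9K)
open B9GeoLemma21KLevelV1 (one_le_Mh)
open B9CubeLettersInvReadDict (hasMajorant_gradF_mul_G_of_eBlockInv hasMajorant_G_mul_gradB_of_eBlockInv)
open B9Cor35CinvAtCubeLetters (kernel_rate_mono)
open B9Thm37CubeCoverCommutators (cutMulY cutMulY_apply hTY)
open B9Thm39CinvTorusRegular (conj_cutMulY)
open B9Eq395Small (hasMajorant_mulOp_left hasMajorant_mul_mulOp_right)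
open B9Eq3104CutoffCommutators (hBdY hBdY_apply DPDsY)
open B9Eq3105AtLetters (DPDsCubeY)
open B9Eq3105ZetaY (zetaY abs_hBdY_zetaY_le_one)
open B9Eq3105FamTwoCore (geo9K_axioms)
open B9Eq3105FamThreeCore (famThree_word_eq' located_words_eq cutMulY_comp_gradY_eq_of_plateau divY_comp_cutMulY_eq_of_plateau
  chiY_eq_one_of_zetaY_gradK chiY_eq_one_of_hTY_gradK hasMajorant_conj_gradWdiv_of_entries)
open B9CubeLettersOpsL0 (GpCubeY)
open B9CubeLettersBondOpsL0 (QpCubeY QpsCubeY XinvCubeY)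
open B9CubeLettersInvReadings (kernelFamilySInv)
open B9Cor36CubeCutoffs (chiY)
open Node00 (SiteY BlkY IBondY FBondY CfgY SiteOpY SiteParY toKT etaS shiftY UboxY QpY QpsY XinvY gradY divY gradK)

variable {d ℓ : ℕ} {hd : 1 ≤ d + 1} {hL : Odd (ℓ + 1) ∧ 1 < ℓ + 1} {b₀ b₁ : ℝ}
variable {𝔸 : Type} [NormedRing 𝔸] [NormedAlgebra ℂ 𝔸] [CompleteSpace 𝔸]
variable {ι : Type} [Fintype ι]
variable (i : KIdx d ℓ hd hL b₀ b₁) (c : ↥(cubes i.D.toDomains)) (b : Module.Basis ι ℝ 𝔸)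

/-! ## §4  The three member words of (A1) at the consumer's letters -/

section MemberWords

variable [Fintype (geo9K i).Site] [DecidableEq (geo9K i).Site] {Rr : ℝ} {Hp : Prop}
variable {B : B9.Backgrounds} (cfg : B.Cfg → CfgY 𝔸 i) (Gp : SiteOpY 𝔸 i) (parS : SiteParY 𝔸 i) {U₁ : B.Cfg}

set_option maxHeartbeats 3200000 in
/-- ★★★ **THE THREE MEMBER WORDS OF (A1) AT THE CONSUMER's LETTERS**: with `A = G′(cfg U₁)` read off `hE : EBlock (kernelFamilySInv i B cfg G′ parS) B_G δ_G U₁`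
((3.42) entries 1–2), `Δ = A − G′_□(V′)` appearing ONLY inside the located differences `M_χ·Δ` (rows cut) and `Δ·M_χ` (columns cut) whose dressed entries
`hDL : ∀ μ, conj b(∇_μ)·conj b(η²M_χΔ) ≺ ε_D·ℓ(a)·e^{−δ_Dd}`, `hDR : ∀ ν, conj b(η²ΔM_χ)·conj b(∇*_ν) ≺ ε_D·ℓ(a)·e^{−δ_Dd}` are DISPLAYED (p. 415 «terms with the differences
G′_{□₀} − G′_□ … are small»; [2] (1.11)–(1.12); supplier NONE), `S = Q′*X⁻¹Q′(cfg U₁)` (bi-contractive `parS`, `hCinv`), a common rate `δ ≤ δ_G, δ_X, δ_D`, (2.61),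
the transfers of `ℓ, ℓ⁻⁴`, `ρ + (2α+β)δ₀ ≤ δ`:
`conj b((D·[(M_χΔ)·S·A + A·S·(ΔM_χ) − (M_χΔ)·S·(ΔM_χ)]·D*)^ℝ) ≺ (M₂Σ‖b_j‖)²B₁Λ⁴c₁²·(d+1)·ε_D·(2K_G + ε_D) · ℓ(a)⁻² · e^{−ρd}` over `(toB6 (geo9K i) Rr Hp, ιB∘blkV1)`,
`K_G = M₂Σ‖b_j‖B_G` — three calls of §3; the constant vanishes with `ε_D`.
[cite: Balaban1985BackgroundPropagators, (3.105) p.414, p.415 l.19–24, p.412 l.22–36, p.399 l.19–24, (3.49) p.399, (3.25) p.394, Thm 3.1 (3.42) p.397, Thm 3.2 (3.48) p.398; Balaban1983RegularityDecay, (1.11)–(1.12); Balaban1984PropagatorsII, (2.51)–(2.55) p.232, Lemma 2.1 (2.60)–(2.61) p.234] -/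
theorem hasMajorant_conj_memberWords {BG δG : ℝ} (hE : EBlock (kernelFamilySInv i B cfg Gp parS) BG δG U₁) (hBG : 0 ≤ BG)
    (ιB : BlkY i → IBondY i) (hι : ∀ s, β i.hN i.D i.hk (ιB s) = s)
    (hpar : ∀ z w : SiteY i, ‖(parS (cfg U₁) z w : 𝔸)‖ ≤ 1 ∧ ‖(((parS (cfg U₁) z w)⁻¹ : 𝔸ˣ) : 𝔸)‖ ≤ 1)
    {M₂ : ℝ} (hM₂ : 0 ≤ M₂) (hrepr : ∀ (v : 𝔸) (j : ι), |b.repr v j| ≤ M₂ * ‖v‖) (hη : etaS i = |i.cf|⁻¹)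
    {s B₁ δX : ℝ} (hs : (etaS i ^ 2 * etaS i ^ 2) * s = 1) (hB₁ : 0 ≤ B₁)
    (hCinv : HasMajorant (g := toB6 (geo9K i) Rr Hp) (fun q : BlkY i × ι => ιB q.1) (conj b (s • (XinvY i parS Gp (cfg U₁)).restrictScalars ℝ))
      (fun a a' => B₁ * ((geo9K i).len a ^ 4)⁻¹ * Real.exp (-(δX * (geo9K i).dist a a'))))
    (χ : SiteY i → ℝ) (V' : CfgY 𝔸 i) {εD δD : ℝ} (hεD : 0 ≤ εD)
    (hDL : ∀ μ : Fin (d + 1), HasMajorant (g := toB6 (geo9K i) Rr Hp) (fun p : SiteY i × ι => ιB (blkOf i.D.toDomains p.1))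
      (conj b (diffLetter (shiftY i) (UboxY i (cfg U₁)) (((etaS i : ℝ) : ℂ))⁻¹ (Sum.inl μ)) *
        conj b ((etaS i ^ 2) • (cutMulY (𝔸 := 𝔸) χ ∘ₗ (Gp (cfg U₁) - GpCubeY i c parS V')).restrictScalars ℝ))
      (fun a a' => εD * (geo9K i).len a * Real.exp (-(δD * (geo9K i).dist a a'))))
    (hDR : ∀ ν : Fin (d + 1), HasMajorant (g := toB6 (geo9K i) Rr Hp) (fun p : SiteY i × ι => ιB (blkOf i.D.toDomains p.1))
      (conj b ((etaS i ^ 2) • ((Gp (cfg U₁) - GpCubeY i c parS V') ∘ₗ cutMulY (𝔸 := 𝔸) χ).restrictScalars ℝ) *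
        conj b (diffLetter (shiftY i) (UboxY i (cfg U₁)) (((etaS i : ℝ) : ℂ))⁻¹ (Sum.inr ν)))
      (fun a a' => εD * (geo9K i).len a * Real.exp (-(δD * (geo9K i).dist a a'))))
    (dB : ℕ) {δ₀ δ α β' ρ Λ : ℝ} (hΛ : 1 ≤ Λ) (hρ : 0 ≤ ρ) (hα : 0 ≤ α) (hβ : 0 ≤ β') (hδ₀ : 0 ≤ δ₀)
    (hδG' : δ ≤ δG) (hδX' : δ ≤ δX) (hδD' : δ ≤ δD) (hr : ρ + (2 * α + β') * δ₀ ≤ δ)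
    (h261 : Ineq261 dB (toB6 (geo9K i) Rr Hp) δ₀ β')
    (hT1 : ScaleTransfer (geo9K i) δ₀ α Λ (fun a => (geo9K i).len a)) (hT4 : ScaleTransfer (geo9K i) δ₀ α Λ (fun a => ((geo9K i).len a ^ 4)⁻¹)) :
    HasMajorant (g := toB6 (geo9K i) Rr Hp) (fun p : FBondY i × ι => ιB (blkV1 i.hN i.D p.1))
      (conj b ((gradY i (cfg U₁) ∘ₗ
        ((cutMulY (𝔸 := 𝔸) χ ∘ₗ (Gp (cfg U₁) - GpCubeY i c parS V')) ∘ₗ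
            (QpsY i parS (cfg U₁) ∘ₗ XinvY i parS Gp (cfg U₁) ∘ₗ QpY i parS (cfg U₁)) ∘ₗ Gp (cfg U₁)
          + Gp (cfg U₁) ∘ₗ (QpsY i parS (cfg U₁) ∘ₗ XinvY i parS Gp (cfg U₁) ∘ₗ QpY i parS (cfg U₁)) ∘ₗ
            ((Gp (cfg U₁) - GpCubeY i c parS V') ∘ₗ cutMulY (𝔸 := 𝔸) χ)
          - (cutMulY (𝔸 := 𝔸) χ ∘ₗ (Gp (cfg U₁) - GpCubeY i c parS V')) ∘ₗ
            (QpsY i parS (cfg U₁) ∘ₗ XinvY i parS Gp (cfg U₁) ∘ₗ QpY i parS (cfg U₁)) ∘ₗ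
            ((Gp (cfg U₁) - GpCubeY i c parS V') ∘ₗ cutMulY (𝔸 := 𝔸) χ))
        ∘ₗ divY i (cfg U₁)).restrictScalars ℝ))
      (fun a y => ((M₂ * ∑ j, ‖b j‖) * (M₂ * ∑ j, ‖b j‖) * B₁ * Λ ^ 4 * B6.c1 dB δ₀ β' ^ 2 *
          (((d : ℝ) + 1) * εD * (2 * (M₂ * (∑ j, ‖b j‖) * BG) + εD))) *
        ((geo9K i).len a ^ 2)⁻¹ * Real.exp (-(ρ * (geo9K i).dist a y))) := by
  obtain ⟨-, -, hdnn⟩ := geo9K_axioms i Rr Hp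
  have hlen : ∀ y : (geo9K i).Site, 0 < (geo9K i).len y := B6KLevelCensusIndexV1.len_pos i
  have hSb : 0 ≤ ∑ j, ‖b j‖ := Finset.sum_nonneg fun _ _ => norm_nonneg _
  have hKG : 0 ≤ M₂ * (∑ j, ‖b j‖) * BG := mul_nonneg (mul_nonneg hM₂ hSb) hBG
  set U : CfgY 𝔸 i := cfg U₁ with hUdef
  set A : (SiteY i → 𝔸) →ₗ[ℂ] (SiteY i → 𝔸) := Gp U with hAdef
  set G₀ : Module.End ℝ (SiteY i → 𝔸) := (etaS i ^ 2) • A.restrictScalars ℝ with hG₀def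
  have hG₀ : ∀ Λm, G₀ Λm = (etaS i ^ 2) • Gp (cfg U₁) Λm := fun Λm => rfl
  -- the member letter's entries 1–2 at the common rate
  have hLA : ∀ μ : Fin (d + 1), HasMajorant (g := toB6 (geo9K i) Rr Hp) (fun p : SiteY i × ι => ιB (blkOf i.D.toDomains p.1))
      (conj b (diffLetter (shiftY i) (UboxY i U) (((etaS i : ℝ) : ℂ))⁻¹ (Sum.inl μ)) * conj b ((etaS i ^ 2) • A.restrictScalars ℝ))
      (fun a a' => M₂ * (∑ j, ‖b j‖) * BG * (geo9K i).len a * Real.exp (-(δ * (geo9K i).dist a a'))) := fun μ =>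
    hasMajorant_mono (g := toB6 (geo9K i) Rr Hp) _
      (hasMajorant_gradF_mul_G_of_eBlockInv i b cfg Gp parS hE hBG ιB hι hM₂ hrepr rfl rfl G₀ hG₀ μ) fun a a' =>
      kernel_rate_mono hdnn hδG' (mul_nonneg hKG (hlen a).le) a a'
  have hRA : ∀ ν : Fin (d + 1), HasMajorant (g := toB6 (geo9K i) Rr Hp) (fun p : SiteY i × ι => ιB (blkOf i.D.toDomains p.1))
      (conj b ((etaS i ^ 2) • A.restrictScalars ℝ) * conj b (diffLetter (shiftY i) (UboxY i U) (((etaS i : ℝ) : ℂ))⁻¹ (Sum.inr ν)))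
      (fun a a' => M₂ * (∑ j, ‖b j‖) * BG * (geo9K i).len a * Real.exp (-(δ * (geo9K i).dist a a'))) := fun ν =>
    hasMajorant_mono (g := toB6 (geo9K i) Rr Hp) _
      (hasMajorant_G_mul_gradB_of_eBlockInv i b cfg Gp parS hE hBG ιB hι hM₂ hrepr rfl rfl G₀ hG₀ ν) fun a a' =>
      kernel_rate_mono hdnn hδG' (mul_nonneg hKG (hlen a).le) a a'
  -- the displayed located-difference entries and the (3.48) block at the common rate
  have hDL' : ∀ μ : Fin (d + 1), HasMajorant (g := toB6 (geo9K i) Rr Hp) (fun p : SiteY i × ι => ιB (blkOf i.D.toDomains p.1))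
      (conj b (diffLetter (shiftY i) (UboxY i U) (((etaS i : ℝ) : ℂ))⁻¹ (Sum.inl μ)) *
        conj b ((etaS i ^ 2) • (cutMulY (𝔸 := 𝔸) χ ∘ₗ (A - GpCubeY i c parS V')).restrictScalars ℝ))
      (fun a a' => εD * (geo9K i).len a * Real.exp (-(δ * (geo9K i).dist a a'))) := fun μ =>
    hasMajorant_mono (g := toB6 (geo9K i) Rr Hp) _ (hDL μ) fun a a' => kernel_rate_mono hdnn hδD' (mul_nonneg hεD (hlen a).le) a a'
  have hDR' : ∀ ν : Fin (d + 1), HasMajorant (g := toB6 (geo9K i) Rr Hp) (fun p : SiteY i × ι => ιB (blkOf i.D.toDomains p.1))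
      (conj b ((etaS i ^ 2) • ((A - GpCubeY i c parS V') ∘ₗ cutMulY (𝔸 := 𝔸) χ).restrictScalars ℝ) *
        conj b (diffLetter (shiftY i) (UboxY i U) (((etaS i : ℝ) : ℂ))⁻¹ (Sum.inr ν)))
      (fun a a' => εD * (geo9K i).len a * Real.exp (-(δ * (geo9K i).dist a a'))) := fun ν =>
    hasMajorant_mono (g := toB6 (geo9K i) Rr Hp) _ (hDR ν) fun a a' => kernel_rate_mono hdnn hδD' (mul_nonneg hεD (hlen a).le) a a'
  have hCinv' : HasMajorant (g := toB6 (geo9K i) Rr Hp) (fun q : BlkY i × ι => ιB q.1) (conj b (s • (XinvY i parS Gp U).restrictScalars ℝ))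
      (fun a a' => B₁ * ((geo9K i).len a ^ 4)⁻¹ * Real.exp (-(δ * (geo9K i).dist a a'))) :=
    hasMajorant_mono (g := toB6 (geo9K i) Rr Hp) _ hCinv fun a a' =>
      kernel_rate_mono hdnn hδX' (mul_nonneg hB₁ (inv_nonneg.2 (pow_nonneg (hlen a).le 4))) a a'
  -- the three words (§3 each)
  have h1 := hasMajorant_conj_gradWdiv_of_entries i b parS Gp ιB U (cutMulY (𝔸 := 𝔸) χ ∘ₗ (A - GpCubeY i c parS V')) A hpar hM₂ hrepr hη hs
    hB₁ hεD hKG hDL' hRA hCinv' dB hΛ hρ hα hβ hδ₀ hr h261 hT1 hT4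
  have h2 := hasMajorant_conj_gradWdiv_of_entries i b parS Gp ιB U A ((A - GpCubeY i c parS V') ∘ₗ cutMulY (𝔸 := 𝔸) χ) hpar hM₂ hrepr hη hs
    hB₁ hKG hεD hLA hDR' hCinv' dB hΛ hρ hα hβ hδ₀ hr h261 hT1 hT4
  have h3 := hasMajorant_conj_gradWdiv_of_entries i b parS Gp ιB U (cutMulY (𝔸 := 𝔸) χ ∘ₗ (A - GpCubeY i c parS V'))
    ((A - GpCubeY i c parS V') ∘ₗ cutMulY (𝔸 := 𝔸) χ) hpar hM₂ hrepr hη hs hB₁ hεD hεD hDL' hDR' hCinv' dB hΛ hρ hα hβ hδ₀ hr h261 hT1 hT4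
  have h123 := hasMajorant_sub (R := Rr) (H := Hp) _ (hasMajorant_add (g := toB6 (geo9K i) Rr Hp) _ h1 h2) h3
  -- the operator is the sum of the three words
  have e : (gradY i U ∘ₗ
        ((cutMulY (𝔸 := 𝔸) χ ∘ₗ (A - GpCubeY i c parS V')) ∘ₗ (QpsY i parS U ∘ₗ XinvY i parS Gp U ∘ₗ QpY i parS U) ∘ₗ A
          + A ∘ₗ (QpsY i parS U ∘ₗ XinvY i parS Gp U ∘ₗ QpY i parS U) ∘ₗ ((A - GpCubeY i c parS V') ∘ₗ cutMulY (𝔸 := 𝔸) χ)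
          - (cutMulY (𝔸 := 𝔸) χ ∘ₗ (A - GpCubeY i c parS V')) ∘ₗ (QpsY i parS U ∘ₗ XinvY i parS Gp U ∘ₗ QpY i parS U) ∘ₗ
            ((A - GpCubeY i c parS V') ∘ₗ cutMulY (𝔸 := 𝔸) χ))
        ∘ₗ divY i U).restrictScalars ℝ =
      (gradY i U ∘ₗ ((cutMulY (𝔸 := 𝔸) χ ∘ₗ (A - GpCubeY i c parS V')) ∘ₗ (QpsY i parS U ∘ₗ XinvY i parS Gp U ∘ₗ QpY i parS U) ∘ₗ A) ∘ₗ
          divY i U).restrictScalars ℝ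
      + (gradY i U ∘ₗ (A ∘ₗ (QpsY i parS U ∘ₗ XinvY i parS Gp U ∘ₗ QpY i parS U) ∘ₗ ((A - GpCubeY i c parS V') ∘ₗ cutMulY (𝔸 := 𝔸) χ)) ∘ₗ
          divY i U).restrictScalars ℝ
      - (gradY i U ∘ₗ ((cutMulY (𝔸 := 𝔸) χ ∘ₗ (A - GpCubeY i c parS V')) ∘ₗ (QpsY i parS U ∘ₗ XinvY i parS Gp U ∘ₗ QpY i parS U) ∘ₗ
          ((A - GpCubeY i c parS V') ∘ₗ cutMulY (𝔸 := 𝔸) χ)) ∘ₗ divY i U).restrictScalars ℝ :=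
    LinearMap.ext fun x => by
      simp only [LinearMap.restrictScalars_apply, LinearMap.comp_apply, LinearMap.add_apply, LinearMap.sub_apply, map_add, map_sub]
  rw [e, B9Eq352DivFormLetters.conj_sub, B9Cor36GpCubeEntriesAtV.conj_add']
  refine hasMajorant_mono (g := toB6 (geo9K i) Rr Hp) _ h123 fun a y => le_of_eq ?_
  ring

end MemberWords

/-! ## §5  The located form (outer cut-offs `ζ_□̃`, `h_□`) and F3-C's binder shape -/

section Located

variable [Fintype (geo9K i).Site] [DecidableEq (geo9K i).Site] {Rr : ℝ} {Hp : Prop}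
variable {B : B9.Backgrounds} (cfg : B.Cfg → CfgY 𝔸 i) (Gp : SiteOpY 𝔸 i) (parS : SiteParY 𝔸 i) {U₁ : B.Cfg}

set_option maxHeartbeats 3200000 in
/-- ★★★ **THE THREE MEMBER WORDS WITH THE OUTER CUT-OFFS, BARE `Δ`**: for ANY site profiles `ζ, h` with `|ζ♭|, |h♭| ≤ 1` whose gradient stencils lie in
the plateau `{χ = 1}` (for the record's `ζ_□̃, h_□, χ_□`: §2), under §4's data:
`conj b((M_ζ·D·[Δ·S·A + A·S·Δ − Δ·S·Δ]·D*·M_h)^ℝ) ≺ κ_F3(ε_D)·ℓ(a)⁻²·e^{−ρd}` — the cut-offs insert `M_χ` next to each `Δ` exactly (§1 `located_words_eq`), then drop out (`|ζ♭|, |h♭| ≤ 1`).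
[cite: Balaban1985BackgroundPropagators, (3.105) p.414, p.415 l.19–24, p.412 l.22–36, (3.49) p.399, (3.3) pp.390–391, (3.8) p.392; Balaban1983RegularityDecay, (1.11)–(1.12); Balaban1984PropagatorsII, (2.51)–(2.55) p.232, Lemma 2.1 (2.61) p.234] -/
theorem hasMajorant_famThree_member_located {BG δG : ℝ} (hE : EBlock (kernelFamilySInv i B cfg Gp parS) BG δG U₁) (hBG : 0 ≤ BG)
    (ιB : BlkY i → IBondY i) (hι : ∀ s, β i.hN i.D i.hk (ιB s) = s)
    (hpar : ∀ z w : SiteY i, ‖(parS (cfg U₁) z w : 𝔸)‖ ≤ 1 ∧ ‖(((parS (cfg U₁) z w)⁻¹ : 𝔸ˣ) : 𝔸)‖ ≤ 1)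
    {M₂ : ℝ} (hM₂ : 0 ≤ M₂) (hrepr : ∀ (v : 𝔸) (j : ι), |b.repr v j| ≤ M₂ * ‖v‖) (hη : etaS i = |i.cf|⁻¹)
    {s B₁ δX : ℝ} (hs : (etaS i ^ 2 * etaS i ^ 2) * s = 1) (hB₁ : 0 ≤ B₁)
    (hCinv : HasMajorant (g := toB6 (geo9K i) Rr Hp) (fun q : BlkY i × ι => ιB q.1) (conj b (s • (XinvY i parS Gp (cfg U₁)).restrictScalars ℝ))
      (fun a a' => B₁ * ((geo9K i).len a ^ 4)⁻¹ * Real.exp (-(δX * (geo9K i).dist a a'))))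
    (χ : SiteY i → ℝ) (V' : CfgY 𝔸 i) {εD δD : ℝ} (hεD : 0 ≤ εD)
    (hDL : ∀ μ : Fin (d + 1), HasMajorant (g := toB6 (geo9K i) Rr Hp) (fun p : SiteY i × ι => ιB (blkOf i.D.toDomains p.1))
      (conj b (diffLetter (shiftY i) (UboxY i (cfg U₁)) (((etaS i : ℝ) : ℂ))⁻¹ (Sum.inl μ)) *
        conj b ((etaS i ^ 2) • (cutMulY (𝔸 := 𝔸) χ ∘ₗ (Gp (cfg U₁) - GpCubeY i c parS V')).restrictScalars ℝ))
      (fun a a' => εD * (geo9K i).len a * Real.exp (-(δD * (geo9K i).dist a a'))))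
    (hDR : ∀ ν : Fin (d + 1), HasMajorant (g := toB6 (geo9K i) Rr Hp) (fun p : SiteY i × ι => ιB (blkOf i.D.toDomains p.1))
      (conj b ((etaS i ^ 2) • ((Gp (cfg U₁) - GpCubeY i c parS V') ∘ₗ cutMulY (𝔸 := 𝔸) χ).restrictScalars ℝ) *
        conj b (diffLetter (shiftY i) (UboxY i (cfg U₁)) (((etaS i : ℝ) : ℂ))⁻¹ (Sum.inr ν)))
      (fun a a' => εD * (geo9K i).len a * Real.exp (-(δD * (geo9K i).dist a a'))))
    (ζ h : SiteY i → ℝ) (hζ1 : ∀ f : FBondY i, |hBdY i ζ f| ≤ 1) (hh1 : ∀ f : FBondY i, |hBdY i h f| ≤ 1)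
    (hζχ : ∀ (f : FBondY i) (z : SiteY i), hBdY i ζ f ≠ 0 → gradK i f z ≠ 0 → χ z = 1)
    (hhχ : ∀ (f : FBondY i) (z : SiteY i), hBdY i h f ≠ 0 → gradK i f z ≠ 0 → χ z = 1)
    (dB : ℕ) {δ₀ δ α β' ρ Λ : ℝ} (hΛ : 1 ≤ Λ) (hρ : 0 ≤ ρ) (hα : 0 ≤ α) (hβ : 0 ≤ β') (hδ₀ : 0 ≤ δ₀)
    (hδG' : δ ≤ δG) (hδX' : δ ≤ δX) (hδD' : δ ≤ δD) (hr : ρ + (2 * α + β') * δ₀ ≤ δ)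
    (h261 : Ineq261 dB (toB6 (geo9K i) Rr Hp) δ₀ β')
    (hT1 : ScaleTransfer (geo9K i) δ₀ α Λ (fun a => (geo9K i).len a)) (hT4 : ScaleTransfer (geo9K i) δ₀ α Λ (fun a => ((geo9K i).len a ^ 4)⁻¹)) :
    HasMajorant (g := toB6 (geo9K i) Rr Hp) (fun p : FBondY i × ι => ιB (blkV1 i.hN i.D p.1))
      (conj b ((cutMulY (𝔸 := 𝔸) (hBdY i ζ) ∘ₗ (gradY i (cfg U₁) ∘ₗ
        ((Gp (cfg U₁) - GpCubeY i c parS V') ∘ₗ (QpsY i parS (cfg U₁) ∘ₗ XinvY i parS Gp (cfg U₁) ∘ₗ QpY i parS (cfg U₁)) ∘ₗ Gp (cfg U₁)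
          + Gp (cfg U₁) ∘ₗ (QpsY i parS (cfg U₁) ∘ₗ XinvY i parS Gp (cfg U₁) ∘ₗ QpY i parS (cfg U₁)) ∘ₗ (Gp (cfg U₁) - GpCubeY i c parS V')
          - (Gp (cfg U₁) - GpCubeY i c parS V') ∘ₗ (QpsY i parS (cfg U₁) ∘ₗ XinvY i parS Gp (cfg U₁) ∘ₗ QpY i parS (cfg U₁)) ∘ₗ
            (Gp (cfg U₁) - GpCubeY i c parS V'))
        ∘ₗ divY i (cfg U₁)) ∘ₗ cutMulY (𝔸 := 𝔸) (hBdY i h)).restrictScalars ℝ))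
      (fun a y => ((M₂ * ∑ j, ‖b j‖) * (M₂ * ∑ j, ‖b j‖) * B₁ * Λ ^ 4 * B6.c1 dB δ₀ β' ^ 2 *
          (((d : ℝ) + 1) * εD * (2 * (M₂ * (∑ j, ‖b j‖) * BG) + εD))) *
        ((geo9K i).len a ^ 2)⁻¹ * Real.exp (-(ρ * (geo9K i).dist a y))) := by
  classical
  have hW := hasMajorant_conj_memberWords i c b cfg Gp parS hE hBG ιB hι hpar hM₂ hrepr hη hs hB₁ hCinv χ V' hεD hDL hDR dB hΛ hρ hα hβ hδ₀
    hδG' hδX' hδD' hr h261 hT1 hT4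
  rw [located_words_eq _ _ _ _ (cutMulY (𝔸 := 𝔸) χ) _ _ _ _ (cutMulY_comp_gradY_eq_of_plateau i (hBdY i ζ) χ (cfg U₁) hζχ)
    (divY_comp_cutMulY_eq_of_plateau i (hBdY i h) χ (cfg U₁) hhχ)]
  set W : (FBondY i → 𝔸) →ₗ[ℂ] (FBondY i → 𝔸) := gradY i (cfg U₁) ∘ₗ
        ((cutMulY (𝔸 := 𝔸) χ ∘ₗ (Gp (cfg U₁) - GpCubeY i c parS V')) ∘ₗ
            (QpsY i parS (cfg U₁) ∘ₗ XinvY i parS Gp (cfg U₁) ∘ₗ QpY i parS (cfg U₁)) ∘ₗ Gp (cfg U₁)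
          + Gp (cfg U₁) ∘ₗ (QpsY i parS (cfg U₁) ∘ₗ XinvY i parS Gp (cfg U₁) ∘ₗ QpY i parS (cfg U₁)) ∘ₗ
            ((Gp (cfg U₁) - GpCubeY i c parS V') ∘ₗ cutMulY (𝔸 := 𝔸) χ)
          - (cutMulY (𝔸 := 𝔸) χ ∘ₗ (Gp (cfg U₁) - GpCubeY i c parS V')) ∘ₗ
            (QpsY i parS (cfg U₁) ∘ₗ XinvY i parS Gp (cfg U₁) ∘ₗ QpY i parS (cfg U₁)) ∘ₗ
            ((Gp (cfg U₁) - GpCubeY i c parS V') ∘ₗ cutMulY (𝔸 := 𝔸) χ))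
        ∘ₗ divY i (cfg U₁) with hW_def
  have e : ((cutMulY (𝔸 := 𝔸) (hBdY i ζ) ∘ₗ W ∘ₗ cutMulY (𝔸 := 𝔸) (hBdY i h)).restrictScalars ℝ : Module.End ℝ (FBondY i → 𝔸)) =
      (cutMulY (𝔸 := 𝔸) (hBdY i ζ)).restrictScalars ℝ * W.restrictScalars ℝ * (cutMulY (𝔸 := 𝔸) (hBdY i h)).restrictScalars ℝ :=
    LinearMap.ext fun _ => rfl
  rw [e, B9Eq352DivFormLetters.conj_mul, B9Eq352DivFormLetters.conj_mul, conj_cutMulY, conj_cutMulY]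
  have hA := hasMajorant_mul_mulOp_right (g := geo9K i) (R := Rr) (H := Hp) (fun p : FBondY i × ι => ιB (blkV1 i.hN i.D p.1))
    (hasMajorant_mulOp_left (G := toB6 (geo9K i) Rr Hp) (fun p : FBondY i × ι => ιB (blkV1 i.hN i.D p.1)) hW
      (fun p : FBondY i × ι => hBdY i ζ p.1) fun p => hζ1 p.1)
    (fun p : FBondY i × ι => hBdY i h p.1) (fun p => hh1 p.1) Finset.univ (fun p _ => Finset.mem_univ _)
  refine hasMajorant_mono (g := toB6 (geo9K i) Rr Hp) _ hA fun a y => le_of_eq ?_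
  rw [if_pos (Finset.mem_univ _), one_mul]

set_option maxHeartbeats 3200000 in
/-- ★★ **F3-C's BINDER SHAPE, MODULO THE `C`-DIFFERENCE WORD**: under F3-A's window hypotheses (`V′ = U₁` on the bonds issued from `supp ζ♭`, `supp h♭`),
§5's data, and a majorant `hT3` of the located cube-letter word `conj b((M_ζ·D·G′_□(S − S_□)G′_□·D*·M_h)^ℝ) ≺ ε₃·ℓ(a)⁻²·e^{−ρd}` (the `C`-difference word, p. 415
«C_{□₀} − C_□ … small by the same reason»; file F3-B3 — DISPLAYED here):
`conj b((M_ζ·(DPDsY parS G′ U₁ − DPDsCubeY □ parS V′)·M_h)^ℝ) ≺ (κ_F3(ε_D) + ε₃)·ℓ(a)⁻²·e^{−ρd}` — the shape of F3-C's `hX □` with `Pl □ := DPDsCubeY i □ parS V′`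
(`= locProjBY i □ parS u Ṽ` at `V′ = Ṽ^{u⁻¹}`, F3-A `locProjBY_eq_DPDsCubeY`).
[cite: Balaban1985BackgroundPropagators, (3.105) p.414, p.415 l.8–24, p.412 l.22–36, (3.25) p.394, (3.49) p.399, Cor. 3.6 p.408; Balaban1983RegularityDecay, (1.11)–(1.12); Balaban1984PropagatorsII, (2.51)–(2.55) p.232, Lemma 2.1 (2.61) p.234] -/
theorem hasMajorant_famThree_located_of_cDiff {BG δG : ℝ} (hE : EBlock (kernelFamilySInv i B cfg Gp parS) BG δG U₁) (hBG : 0 ≤ BG)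
    (ιB : BlkY i → IBondY i) (hι : ∀ s, β i.hN i.D i.hk (ιB s) = s)
    (hpar : ∀ z w : SiteY i, ‖(parS (cfg U₁) z w : 𝔸)‖ ≤ 1 ∧ ‖(((parS (cfg U₁) z w)⁻¹ : 𝔸ˣ) : 𝔸)‖ ≤ 1)
    {M₂ : ℝ} (hM₂ : 0 ≤ M₂) (hrepr : ∀ (v : 𝔸) (j : ι), |b.repr v j| ≤ M₂ * ‖v‖) (hη : etaS i = |i.cf|⁻¹)
    {s B₁ δX : ℝ} (hs : (etaS i ^ 2 * etaS i ^ 2) * s = 1) (hB₁ : 0 ≤ B₁)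
    (hCinv : HasMajorant (g := toB6 (geo9K i) Rr Hp) (fun q : BlkY i × ι => ιB q.1) (conj b (s • (XinvY i parS Gp (cfg U₁)).restrictScalars ℝ))
      (fun a a' => B₁ * ((geo9K i).len a ^ 4)⁻¹ * Real.exp (-(δX * (geo9K i).dist a a'))))
    (χ : SiteY i → ℝ) (V' : CfgY 𝔸 i) {εD δD : ℝ} (hεD : 0 ≤ εD)
    (hDL : ∀ μ : Fin (d + 1), HasMajorant (g := toB6 (geo9K i) Rr Hp) (fun p : SiteY i × ι => ιB (blkOf i.D.toDomains p.1))
      (conj b (diffLetter (shiftY i) (UboxY i (cfg U₁)) (((etaS i : ℝ) : ℂ))⁻¹ (Sum.inl μ)) *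
        conj b ((etaS i ^ 2) • (cutMulY (𝔸 := 𝔸) χ ∘ₗ (Gp (cfg U₁) - GpCubeY i c parS V')).restrictScalars ℝ))
      (fun a a' => εD * (geo9K i).len a * Real.exp (-(δD * (geo9K i).dist a a'))))
    (hDR : ∀ ν : Fin (d + 1), HasMajorant (g := toB6 (geo9K i) Rr Hp) (fun p : SiteY i × ι => ιB (blkOf i.D.toDomains p.1))
      (conj b ((etaS i ^ 2) • ((Gp (cfg U₁) - GpCubeY i c parS V') ∘ₗ cutMulY (𝔸 := 𝔸) χ).restrictScalars ℝ) *
        conj b (diffLetter (shiftY i) (UboxY i (cfg U₁)) (((etaS i : ℝ) : ℂ))⁻¹ (Sum.inr ν)))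
      (fun a a' => εD * (geo9K i).len a * Real.exp (-(δD * (geo9K i).dist a a'))))
    (ζ h : SiteY i → ℝ) (hζ1 : ∀ f : FBondY i, |hBdY i ζ f| ≤ 1) (hh1 : ∀ f : FBondY i, |hBdY i h f| ≤ 1)
    (hζχ : ∀ (f : FBondY i) (z : SiteY i), hBdY i ζ f ≠ 0 → gradK i f z ≠ 0 → χ z = 1)
    (hhχ : ∀ (f : FBondY i) (z : SiteY i), hBdY i h f ≠ 0 → gradK i f z ≠ 0 → χ z = 1)
    (hζw : ∀ f : FBondY i, hBdY i ζ f ≠ 0 → V' f.dir f.src = cfg U₁ f.dir f.src)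
    (hhw : ∀ f : FBondY i, hBdY i h f ≠ 0 → V' f.dir f.src = cfg U₁ f.dir f.src)
    (dB : ℕ) {δ₀ δ α β' ρ Λ : ℝ} (hΛ : 1 ≤ Λ) (hρ : 0 ≤ ρ) (hα : 0 ≤ α) (hβ : 0 ≤ β') (hδ₀ : 0 ≤ δ₀)
    (hδG' : δ ≤ δG) (hδX' : δ ≤ δX) (hδD' : δ ≤ δD) (hr : ρ + (2 * α + β') * δ₀ ≤ δ)
    (h261 : Ineq261 dB (toB6 (geo9K i) Rr Hp) δ₀ β')
    (hT1 : ScaleTransfer (geo9K i) δ₀ α Λ (fun a => (geo9K i).len a)) (hT4 : ScaleTransfer (geo9K i) δ₀ α Λ (fun a => ((geo9K i).len a ^ 4)⁻¹))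
    {ε₃ : ℝ}
    (hT3 : HasMajorant (g := toB6 (geo9K i) Rr Hp) (fun p : FBondY i × ι => ιB (blkV1 i.hN i.D p.1))
      (conj b ((cutMulY (𝔸 := 𝔸) (hBdY i ζ) ∘ₗ (gradY i (cfg U₁) ∘ₗ
        (GpCubeY i c parS V' ∘ₗ ((QpsY i parS (cfg U₁) ∘ₗ XinvY i parS Gp (cfg U₁) ∘ₗ QpY i parS (cfg U₁))
            - (QpsCubeY i c parS V' ∘ₗ XinvCubeY i c parS V' ∘ₗ QpCubeY i c parS V')) ∘ₗ GpCubeY i c parS V')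
        ∘ₗ divY i (cfg U₁)) ∘ₗ cutMulY (𝔸 := 𝔸) (hBdY i h)).restrictScalars ℝ))
      (fun a y => ε₃ * ((geo9K i).len a ^ 2)⁻¹ * Real.exp (-(ρ * (geo9K i).dist a y)))) :
    HasMajorant (g := toB6 (geo9K i) Rr Hp) (fun p : FBondY i × ι => ιB (blkV1 i.hN i.D p.1))
      (conj b ((cutMulY (𝔸 := 𝔸) (hBdY i ζ) * (DPDsY i parS Gp (cfg U₁) - DPDsCubeY i c parS V') * cutMulY (𝔸 := 𝔸) (hBdY i h)).restrictScalars ℝ))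
      (fun a y => ((M₂ * ∑ j, ‖b j‖) * (M₂ * ∑ j, ‖b j‖) * B₁ * Λ ^ 4 * B6.c1 dB δ₀ β' ^ 2 *
          (((d : ℝ) + 1) * εD * (2 * (M₂ * (∑ j, ‖b j‖) * BG) + εD)) + ε₃) *
        ((geo9K i).len a ^ 2)⁻¹ * Real.exp (-(ρ * (geo9K i).dist a y))) := by
  have hM := hasMajorant_famThree_member_located i c b cfg Gp parS hE hBG ιB hι hpar hM₂ hrepr hη hs hB₁ hCinv χ V' hεD hDL hDR ζ h hζ1 hh1 hζχ hhχ
    dB hΛ hρ hα hβ hδ₀ hδG' hδX' hδD' hr h261 hT1 hT4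
  have e0 : cutMulY (𝔸 := 𝔸) (hBdY i ζ) * (DPDsY i parS Gp (cfg U₁) - DPDsCubeY i c parS V') * cutMulY (𝔸 := 𝔸) (hBdY i h) =
      cutMulY (𝔸 := 𝔸) (hBdY i ζ) ∘ₗ (DPDsY i parS Gp (cfg U₁) - DPDsCubeY i c parS V') ∘ₗ cutMulY (𝔸 := 𝔸) (hBdY i h) := by
    rw [Module.End.mul_eq_comp, Module.End.mul_eq_comp, LinearMap.comp_assoc]
  rw [e0, famThree_word_eq' i c parS Gp (cfg U₁) V' (hBdY i ζ) (hBdY i h) hζw hhw]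
  -- split off the `C`-difference word
  set Mz := cutMulY (𝔸 := 𝔸) (hBdY i ζ) with hMz
  set Mh := cutMulY (𝔸 := 𝔸) (hBdY i h) with hMh
  set A := Gp (cfg U₁) with hA
  set Bc := GpCubeY i c parS V' with hBc
  set S := QpsY i parS (cfg U₁) ∘ₗ XinvY i parS Gp (cfg U₁) ∘ₗ QpY i parS (cfg U₁) with hS
  set Sc := QpsCubeY i c parS V' ∘ₗ XinvCubeY i c parS V' ∘ₗ QpCubeY i c parS V' with hSc
  set D := gradY i (cfg U₁) with hD
  set Ds := divY i (cfg U₁) with hDs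
  have e1 : Mz ∘ₗ (D ∘ₗ ((A - Bc) ∘ₗ S ∘ₗ A + A ∘ₗ S ∘ₗ (A - Bc) - (A - Bc) ∘ₗ S ∘ₗ (A - Bc) + Bc ∘ₗ (S - Sc) ∘ₗ Bc) ∘ₗ Ds) ∘ₗ Mh =
      Mz ∘ₗ (D ∘ₗ ((A - Bc) ∘ₗ S ∘ₗ A + A ∘ₗ S ∘ₗ (A - Bc) - (A - Bc) ∘ₗ S ∘ₗ (A - Bc)) ∘ₗ Ds) ∘ₗ Mh
        + Mz ∘ₗ (D ∘ₗ (Bc ∘ₗ (S - Sc) ∘ₗ Bc) ∘ₗ Ds) ∘ₗ Mh := by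
    simp only [LinearMap.add_comp, LinearMap.comp_add, LinearMap.sub_comp, LinearMap.comp_sub]
  have e2 : ((Mz ∘ₗ (D ∘ₗ ((A - Bc) ∘ₗ S ∘ₗ A + A ∘ₗ S ∘ₗ (A - Bc) - (A - Bc) ∘ₗ S ∘ₗ (A - Bc)) ∘ₗ Ds) ∘ₗ Mh
        + Mz ∘ₗ (D ∘ₗ (Bc ∘ₗ (S - Sc) ∘ₗ Bc) ∘ₗ Ds) ∘ₗ Mh).restrictScalars ℝ : Module.End ℝ (FBondY i → 𝔸)) =
      (Mz ∘ₗ (D ∘ₗ ((A - Bc) ∘ₗ S ∘ₗ A + A ∘ₗ S ∘ₗ (A - Bc) - (A - Bc) ∘ₗ S ∘ₗ (A - Bc)) ∘ₗ Ds) ∘ₗ Mh).restrictScalars ℝ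
        + (Mz ∘ₗ (D ∘ₗ (Bc ∘ₗ (S - Sc) ∘ₗ Bc) ∘ₗ Ds) ∘ₗ Mh).restrictScalars ℝ :=
    LinearMap.ext fun _ => rfl
  rw [e1, e2, B9Cor36GpCubeEntriesAtV.conj_add']
  refine hasMajorant_mono (g := toB6 (geo9K i) Rr Hp) _ (hasMajorant_add (g := toB6 (geo9K i) Rr Hp) _ hM hT3) fun a y => le_of_eq ?_
  ring

/-- ★★ **THE RECORD's INSTANCE**: `ζ := zetaY i □`, `h := hTY i □`, `χ := chiY i □` — the plateau hypotheses `hζχ`, `hhχ` and `|ζ♭|, |h♭| ≤ 1` DISCHARGED (§2,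
`B9Eq3105ZetaY`); displayed: `hE`, `hCinv`, `hpar`, `η = |c_f|⁻¹`, the located entries `hDL`∕`hDR` at `χ_□`, the window at `V′`, the `C`-difference word `hT3`, the
member (2.61) ∕ transfers.  This is F3-C's `hX □` for `Pl □ := DPDsCubeY i □ parS V′`.
[cite: Balaban1985BackgroundPropagators, (3.105) p.414 («ζ_□̃ = 1 on a cube containing □»), p.415 l.8–24, p.408, (3.87) p.409, Cor. 3.6 p.408; Balaban1983RegularityDecay, (1.11)–(1.12); Balaban1984PropagatorsII, (2.51)–(2.55) p.232, Lemma 2.1 (2.61) p.234] -/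
theorem hasMajorant_famThree_located_zetaY_of_cDiff {BG δG : ℝ} (hE : EBlock (kernelFamilySInv i B cfg Gp parS) BG δG U₁) (hBG : 0 ≤ BG)
    (ιB : BlkY i → IBondY i) (hι : ∀ s, β i.hN i.D i.hk (ιB s) = s)
    (hpar : ∀ z w : SiteY i, ‖(parS (cfg U₁) z w : 𝔸)‖ ≤ 1 ∧ ‖(((parS (cfg U₁) z w)⁻¹ : 𝔸ˣ) : 𝔸)‖ ≤ 1)
    {M₂ : ℝ} (hM₂ : 0 ≤ M₂) (hrepr : ∀ (v : 𝔸) (j : ι), |b.repr v j| ≤ M₂ * ‖v‖) (hη : etaS i = |i.cf|⁻¹)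
    {s B₁ δX : ℝ} (hs : (etaS i ^ 2 * etaS i ^ 2) * s = 1) (hB₁ : 0 ≤ B₁)
    (hCinv : HasMajorant (g := toB6 (geo9K i) Rr Hp) (fun q : BlkY i × ι => ιB q.1) (conj b (s • (XinvY i parS Gp (cfg U₁)).restrictScalars ℝ))
      (fun a a' => B₁ * ((geo9K i).len a ^ 4)⁻¹ * Real.exp (-(δX * (geo9K i).dist a a'))))
    (V' : CfgY 𝔸 i) {εD δD : ℝ} (hεD : 0 ≤ εD)
    (hDL : ∀ μ : Fin (d + 1), HasMajorant (g := toB6 (geo9K i) Rr Hp) (fun p : SiteY i × ι => ιB (blkOf i.D.toDomains p.1))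
      (conj b (diffLetter (shiftY i) (UboxY i (cfg U₁)) (((etaS i : ℝ) : ℂ))⁻¹ (Sum.inl μ)) *
        conj b ((etaS i ^ 2) • (cutMulY (𝔸 := 𝔸) (chiY i c) ∘ₗ (Gp (cfg U₁) - GpCubeY i c parS V')).restrictScalars ℝ))
      (fun a a' => εD * (geo9K i).len a * Real.exp (-(δD * (geo9K i).dist a a'))))
    (hDR : ∀ ν : Fin (d + 1), HasMajorant (g := toB6 (geo9K i) Rr Hp) (fun p : SiteY i × ι => ιB (blkOf i.D.toDomains p.1))
      (conj b ((etaS i ^ 2) • ((Gp (cfg U₁) - GpCubeY i c parS V') ∘ₗ cutMulY (𝔸 := 𝔸) (chiY i c)).restrictScalars ℝ) *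
        conj b (diffLetter (shiftY i) (UboxY i (cfg U₁)) (((etaS i : ℝ) : ℂ))⁻¹ (Sum.inr ν)))
      (fun a a' => εD * (geo9K i).len a * Real.exp (-(δD * (geo9K i).dist a a'))))
    (hζw : ∀ f : FBondY i, hBdY i (zetaY i c) f ≠ 0 → V' f.dir f.src = cfg U₁ f.dir f.src)
    (hhw : ∀ f : FBondY i, hBdY i (hTY i c) f ≠ 0 → V' f.dir f.src = cfg U₁ f.dir f.src)
    (dB : ℕ) {δ₀ δ α β' ρ Λ : ℝ} (hΛ : 1 ≤ Λ) (hρ : 0 ≤ ρ) (hα : 0 ≤ α) (hβ : 0 ≤ β') (hδ₀ : 0 ≤ δ₀)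
    (hδG' : δ ≤ δG) (hδX' : δ ≤ δX) (hδD' : δ ≤ δD) (hr : ρ + (2 * α + β') * δ₀ ≤ δ)
    (h261 : Ineq261 dB (toB6 (geo9K i) Rr Hp) δ₀ β')
    (hT1 : ScaleTransfer (geo9K i) δ₀ α Λ (fun a => (geo9K i).len a)) (hT4 : ScaleTransfer (geo9K i) δ₀ α Λ (fun a => ((geo9K i).len a ^ 4)⁻¹))
    {ε₃ : ℝ}
    (hT3 : HasMajorant (g := toB6 (geo9K i) Rr Hp) (fun p : FBondY i × ι => ιB (blkV1 i.hN i.D p.1))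
      (conj b ((cutMulY (𝔸 := 𝔸) (hBdY i (zetaY i c)) ∘ₗ (gradY i (cfg U₁) ∘ₗ
        (GpCubeY i c parS V' ∘ₗ ((QpsY i parS (cfg U₁) ∘ₗ XinvY i parS Gp (cfg U₁) ∘ₗ QpY i parS (cfg U₁))
            - (QpsCubeY i c parS V' ∘ₗ XinvCubeY i c parS V' ∘ₗ QpCubeY i c parS V')) ∘ₗ GpCubeY i c parS V')
        ∘ₗ divY i (cfg U₁)) ∘ₗ cutMulY (𝔸 := 𝔸) (hBdY i (hTY i c))).restrictScalars ℝ))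
      (fun a y => ε₃ * ((geo9K i).len a ^ 2)⁻¹ * Real.exp (-(ρ * (geo9K i).dist a y)))) :
    HasMajorant (g := toB6 (geo9K i) Rr Hp) (fun p : FBondY i × ι => ιB (blkV1 i.hN i.D p.1))
      (conj b ((cutMulY (𝔸 := 𝔸) (hBdY i (zetaY i c)) * (DPDsY i parS Gp (cfg U₁) - DPDsCubeY i c parS V') *
        cutMulY (𝔸 := 𝔸) (hBdY i (hTY i c))).restrictScalars ℝ))
      (fun a y => ((M₂ * ∑ j, ‖b j‖) * (M₂ * ∑ j, ‖b j‖) * B₁ * Λ ^ 4 * B6.c1 dB δ₀ β' ^ 2 *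
          (((d : ℝ) + 1) * εD * (2 * (M₂ * (∑ j, ‖b j‖) * BG) + εD)) + ε₃) *
        ((geo9K i).len a ^ 2)⁻¹ * Real.exp (-(ρ * (geo9K i).dist a y))) :=
  hasMajorant_famThree_located_of_cDiff i c b cfg Gp parS hE hBG ιB hι hpar hM₂ hrepr hη hs hB₁ hCinv (chiY i c) V' hεD hDL hDR
    (zetaY i c) (hTY i c) (fun f => abs_hBdY_zetaY_le_one i c f)
    (fun _ => B6Partition118KLevelTorus.abs_hT_le_one i.D (one_le_Mh i) (B9GeoLemma21KLevelV1.one_le_P i) c _)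
    (fun _ _ hf hz => chiY_eq_one_of_zetaY_gradK i c hf hz) (fun _ _ hf hz => chiY_eq_one_of_hTY_gradK i c hf hz) hζw hhw
    dB hΛ hρ hα hβ hδ₀ hδG' hδX' hδD' hr h261 hT1 hT4 hT3

end Located

end Literature.MathematicalPhysics.QuantumFieldTheory.Balaban1983to89.B9Eq3105FamThreeMember

end
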